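import Mathlib
import HarnessLib
import Summits.HubbardSuperconductivity.HubbardSuperconductivity.Theorems.KLProgrammeKLRegimeSectorSubEntrySum
import Summits.HubbardSuperconductivity.HubbardSuperconductivity.Theorems.KLProgrammeKLRegimeSectorRadialAlignment
import Summits.HubbardSuperconductivity.HubbardSuperconductivity.Theorems.KLProgrammeKLRegimeEngineNormsStepDoor

/-!
# Route `KLProgramme` — ENGINE child gen 8 (stmt-HubbardSuperconductivity-20437 `KLRegimeEngineV17F2`), skeleton v2 class #3 witness input GAP L2:
# the SHARP (β-uniform) sector entry bound of the SOFT covariance `D_{n′} = klSoftCov … n′`, modulo ONE annulus count of the sector family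
# (cell gate-hubbard-kl, seat hubbard-kl-k3c2-p2 g8, value/(T) lane)

The soft covariance is the slice `C^K_{(Λ_{n_β+1}, Λ_{n′}]}` (`klSoftCov_eq_sliceCT_nScales_succ`), a normal covariance whose symbol is
POINTWISE `≤ βL²/ρ`, `ρ = √(ω² + e_K²)` (not just `≤ 2βL²/Λ_{n_β+1}`, which is the crude law's loss) and supported in `Λ_{n_β+1}/2 < ρ < Λ_{n′}`:

* §1 `norm_I_mul_add_div'` (`‖(iω+e)/(ω²+e²)‖ = 1/√(ω²+e²)`), **`norm_sliceSymbolCT_le_div_radius`** (`‖symbol(ks)‖ ≤ βL²/√(ω²+e_K²)`, every `ks`),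
  `sliceSymbolCT_radius_mem` (symbol `≠ 0 ⇒ Λ/2 < ρ ∧ ρ < Λ′`);
* §2 **`norm_entry_sectorSub_sliceCT_le_of_annulusCount`** — for ANY family `‖F_ω‖ ≤ 1` and ANY slice `0 < Λ ≤ Λ′`: if the sector `ω_Y`'s support
  has annulus counts `#{k : F_{ω_Y}(k) ≠ 0, r/2 < ρ(k) ≤ r} ≤ C·r²` for `0 < r ≤ Λ′`, then
  `‖(S(F)ᵀ·C^K_{(Λ,Λ′]}·S(F)) Y Y′‖ ≤ ‖(βL²)⁻¹‖²·(4·βL²·C·Λ′)` — NO `Λ′/Λ` factor (dyadic lemma of …SoftLineDyadicSum with floor `ρmin = Λ/2`);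
* §3 **`norm_entry_sectorSub_klSoftCov_le_of_annulusCount`** — the soft covariance `klSoftCov … n′` under `klBetaMin ≤ β`:
  `‖(S(F)ᵀ·D_{n′}·S(F)) Y Y′‖ ≤ ‖(βL²)⁻¹‖²·(4·βL²·C·Λ_{n′})`.

What GAP L2 still needs (successor, BandSectorCounting currency): the annulus count for the fat/anisotropic family at index `n ≤ n′`,
`C = C_m·βL²·w_n` (time window `rβ/π + 1` × thin curved box `r × w_n` on the lattice, `L ≥ klEngL₃`, `M ≥ klEngM₃`), whence the entry is
`≤ 16·C_m·w_n·Λ_{n′} ≍ C_D·e₀·8^{−n}` — p5's l.3059 shape — and the Gram twin through `norm_sectorGramF/G_le_of_count`'s sum analogue.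
Nothing about the model's correlation functions is asserted; nothing asserts superconductivity.
-/

noncomputable section

namespace Summit.HubbardSuperconductivity.HubbardSuperconductivity.Theorems.TorusFourierL2

set_option linter.dupNamespace false -- summit = problem name (single-conjunct summit), D-0017

open Finset Literature.MathematicalPhysics.QuantumLattice Literature.Probability.LatticeModels
open Summit.HubbardSuperconductivity.HubbardSuperconductivity.Theorems.KLRegimeSplit
open Summit.HubbardSuperconductivity.HubbardSuperconductivity.Theorems.KLRegimeWick
open Summit.HubbardSuperconductivity.HubbardSuperconductivity.Theorems.KLProgrammeLegKernels
open scoped ComplexConjugate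

variable {L M N : ℕ} [NeZero L]

/-! ## §1 The slice symbol is soft-shaped: `‖symbol‖ ≤ βL²/ρ` pointwise -/

/-- `‖(iω + e)/(ω² + e²)‖ = 1/√(ω² + e²)` (also at `ω = e = 0`, where both sides vanish). -/
theorem norm_I_mul_add_div' (ω ξ : ℝ) :
    ‖(Complex.I * (ω : ℂ) + (ξ : ℂ)) / (((ω ^ 2 + ξ ^ 2 : ℝ)) : ℂ)‖ = 1 / Real.sqrt (ω ^ 2 + ξ ^ 2) := by
  have hnum : ‖Complex.I * (ω : ℂ) + (ξ : ℂ)‖ = Real.sqrt (ω ^ 2 + ξ ^ 2) := by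
    rw [Complex.norm_eq_sqrt_sq_add_sq]
    congr 1
    simp [Complex.add_re, Complex.add_im, Complex.mul_re, Complex.mul_im]
    ring
  rw [norm_div, hnum, Complex.norm_real, Real.norm_eq_abs, abs_of_nonneg (by positivity)]
  by_cases h0 : ω ^ 2 + ξ ^ 2 = 0
  · rw [h0, Real.sqrt_zero]; simp
  · have hpos : 0 < ω ^ 2 + ξ ^ 2 := lt_of_le_of_ne (by positivity) (Ne.symm h0)
    rw [div_eq_div_iff (by positivity) (Real.sqrt_pos.2 hpos).ne', one_mul, Real.mul_self_sqrt hpos.le]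

omit [NeZero L] in
/-- **The slice symbol is soft-shaped**: `‖(w^K_Λ − w^K_{Λ′})(ks)·βL²·(iω + e_K)/den_K‖ ≤ βL²/√(ω² + e_K²)` for EVERY label (`0 ≤ β`;
the weight difference has modulus `≤ 1`). -/
theorem norm_sliceSymbolCT_le_div_radius {β : ℝ} (hβ : 0 ≤ β) (μ : ℝ) (K : TrigPolyC4v) (Λ Λ' : ℝ) (ks : FreqMomentum L M × Fin 2) :
    ‖((hubbardCutoffWeightCT L M β μ K Λ ks.1 : ℂ) - (hubbardCutoffWeightCT L M β μ K Λ' ks.1 : ℂ)) *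
        (((β * (L : ℝ) ^ 2 : ℝ) : ℂ) *
          ((Complex.I * matsubaraFreq β M ks.1.1 + nambuXiCT L μ K ks.1.2) / nambuDenCT L M β μ 0 K ks.1))‖ ≤
      β * (L : ℝ) ^ 2 / Real.sqrt (matsubaraFreq β M ks.1.1 ^ 2 + nambuXiCT L μ K ks.1.2 ^ 2) := by
  set ω : ℝ := matsubaraFreq β M ks.1.1 with hω
  set ξ : ℝ := nambuXiCT L μ K ks.1.2 with hξ
  have hw : ‖((hubbardCutoffWeightCT L M β μ K Λ ks.1 : ℂ) - (hubbardCutoffWeightCT L M β μ K Λ' ks.1 : ℂ))‖ ≤ 1 := by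
    have hwdef : hubbardCutoffWeightCT L M β μ K Λ ks.1 - hubbardCutoffWeightCT L M β μ K Λ' ks.1 =
        salmhoferCutoff ((ω ^ 2 + ξ ^ 2) / Λ ^ 2) - salmhoferCutoff ((ω ^ 2 + ξ ^ 2) / Λ' ^ 2) := by
      simp only [hubbardCutoffWeightCT, hω, hξ]
    rw [← Complex.ofReal_sub, Complex.norm_real, Real.norm_eq_abs, hwdef]
    exact abs_sliceCutoff_le_one _ Λ Λ'
  have hden : (nambuDenCT L M β μ 0 K ks.1 : ℝ) = ω ^ 2 + ξ ^ 2 := by rw [nambuDenCT_zero_seed]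
  have hsym : ‖(Complex.I * (ω : ℂ) + (ξ : ℂ)) / ((nambuDenCT L M β μ 0 K ks.1 : ℝ) : ℂ)‖ = 1 / Real.sqrt (ω ^ 2 + ξ ^ 2) := by
    rw [hden]; exact norm_I_mul_add_div' ω ξ
  have hβL : ‖(((β * (L : ℝ) ^ 2 : ℝ)) : ℂ)‖ = β * (L : ℝ) ^ 2 := by
    rw [Complex.norm_real, Real.norm_eq_abs, abs_of_nonneg (by positivity)]
  have hs0 : 0 ≤ 1 / Real.sqrt (ω ^ 2 + ξ ^ 2) := by positivity
  calc ‖((hubbardCutoffWeightCT L M β μ K Λ ks.1 : ℂ) - (hubbardCutoffWeightCT L M β μ K Λ' ks.1 : ℂ)) *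
          (((β * (L : ℝ) ^ 2 : ℝ) : ℂ) * ((Complex.I * (ω : ℂ) + (ξ : ℂ)) / ((nambuDenCT L M β μ 0 K ks.1 : ℝ) : ℂ)))‖
      = ‖((hubbardCutoffWeightCT L M β μ K Λ ks.1 : ℂ) - (hubbardCutoffWeightCT L M β μ K Λ' ks.1 : ℂ))‖ *
          ((β * (L : ℝ) ^ 2) * (1 / Real.sqrt (ω ^ 2 + ξ ^ 2))) := by
        rw [norm_mul, norm_mul, hβL, hsym]
    _ ≤ 1 * ((β * (L : ℝ) ^ 2) * (1 / Real.sqrt (ω ^ 2 + ξ ^ 2))) :=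
        mul_le_mul_of_nonneg_right hw (mul_nonneg (by positivity) hs0)
    _ = β * (L : ℝ) ^ 2 / Real.sqrt (ω ^ 2 + ξ ^ 2) := by ring

omit [NeZero L] in
/-- **Radial support of the slice symbol**: a nonzero symbol at `ks` forces `Λ/2 < ρ(ks) < Λ′`, `ρ = √(ω² + e_K²)` (`0 < Λ ≤ Λ′`). -/
theorem sliceSymbolCT_radius_mem [NeZero M] {β : ℝ} (μ : ℝ) (K : TrigPolyC4v) {Λ Λ' : ℝ} (hΛ : 0 < Λ) (hΛΛ' : Λ ≤ Λ')
    {ks : FreqMomentum L M × Fin 2}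
    (h : ((hubbardCutoffWeightCT L M β μ K Λ ks.1 : ℂ) - (hubbardCutoffWeightCT L M β μ K Λ' ks.1 : ℂ)) *
        (((β * (L : ℝ) ^ 2 : ℝ) : ℂ) *
          ((Complex.I * matsubaraFreq β M ks.1.1 + nambuXiCT L μ K ks.1.2) / nambuDenCT L M β μ 0 K ks.1)) ≠ 0) :
    Λ / 2 < Real.sqrt (matsubaraFreq β M ks.1.1 ^ 2 + nambuXiCT L μ K ks.1.2 ^ 2) ∧
      Real.sqrt (matsubaraFreq β M ks.1.1 ^ 2 + nambuXiCT L μ K ks.1.2 ^ 2) < Λ' := by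
  have hw : (hubbardCutoffWeightCT L M β μ K Λ ks.1 : ℂ) - (hubbardCutoffWeightCT L M β μ K Λ' ks.1 : ℂ) ≠ 0 :=
    left_ne_zero_of_mul h
  have hw0 : hubbardCutoffWeightCT L M β μ K Λ ks.1 - hubbardCutoffWeightCT L M β μ K Λ' ks.1 ≠ 0 := by
    intro h0; apply hw; rw [← Complex.ofReal_sub, h0, Complex.ofReal_zero]
  have hw' : salmhoferCutoff ((matsubaraFreq β M ks.1.1 ^ 2 + nambuXiCT L μ K ks.1.2 ^ 2) / Λ ^ 2) -
      salmhoferCutoff ((matsubaraFreq β M ks.1.1 ^ 2 + nambuXiCT L μ K ks.1.2 ^ 2) / Λ' ^ 2) ≠ 0 := by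
    simpa only [hubbardCutoffWeightCT] using hw0
  obtain ⟨hlo, hhi⟩ := support_sliceCutoff hΛ hΛΛ' hw'
  set s : ℝ := matsubaraFreq β M ks.1.1 ^ 2 + nambuXiCT L μ K ks.1.2 ^ 2 with hs
  have hs0 : 0 ≤ s := by rw [hs]; positivity
  constructor
  · rw [show Λ / 2 = Real.sqrt ((Λ / 2) ^ 2) by rw [Real.sqrt_sq (by positivity)]]
    exact Real.sqrt_lt_sqrt (by positivity) (by linarith)
  · rw [show Λ' = Real.sqrt (Λ' ^ 2) by rw [Real.sqrt_sq (by linarith)]]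
    exact Real.sqrt_lt_sqrt hs0 hhi

/-! ## §2 The β-uniform sector entry bound of ANY slice, modulo the sector's annulus count -/

/-- **Sector entry bound of a slice covariance, β-UNIFORM**: for a family `‖F_ω‖ ≤ 1`, a slice `0 < Λ ≤ Λ′`, and annulus counts
`#{k : F_{ω_Y}(k) ≠ 0, r/2 < ρ(k) ≤ r} ≤ C·r²` (`0 < r ≤ Λ′`, `ρ(k) = √(ω_k² + e_K(k⃗)²)`):
`‖(S(F)ᵀ·C^K_{(Λ,Λ′]}·S(F)) Y Y′‖ ≤ ‖(βL²)⁻¹‖²·(4·βL²·C·Λ′)` — no `Λ′/Λ`. -/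
theorem norm_entry_sectorSub_sliceCT_le_of_annulusCount [NeZero M] {β : ℝ} (hβ : 0 ≤ β) (μ : ℝ) (K : TrigPolyC4v) {Λ Λ' : ℝ}
    (hΛ : 0 < Λ) (hΛΛ' : Λ ≤ Λ') (F : Fin N → FreqMomentum L M → ℂ) (hF : ∀ ω k, ‖F ω k‖ ≤ 1)
    (Y Y' : SpaceTimeIdx L M × SectorLeg N) {C : ℝ} (hC : 0 ≤ C)
    (hcount : ∀ r : ℝ, 0 < r → r ≤ Λ' →
      ((((univ : Finset (FreqMomentum L M)).filter (fun k => F Y.2.1.1 k ≠ 0)).filter fun k =>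
          r / 2 < Real.sqrt (matsubaraFreq β M k.1 ^ 2 + nambuXiCT L μ K k.2 ^ 2) ∧
            Real.sqrt (matsubaraFreq β M k.1 ^ 2 + nambuXiCT L μ K k.2 ^ 2) ≤ r).card : ℝ) ≤ C * r ^ 2) :
    ‖((sectorSubMatrix L M β F).transpose * hubbardCovSliceCT L M β μ 0 K Λ Λ' * sectorSubMatrix L M β F) Y Y'‖ ≤
      ‖((1 / (β * (L : ℝ) ^ 2) : ℝ) : ℂ)‖ ^ 2 * (4 * (β * (L : ℝ) ^ 2) * C * Λ') := by
  classical
  rw [hubbardCovSliceCT_zero_seed]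
  -- the symbol restricted to the support of `F_{ω_Y}`, killed off its own support: use the TRUNCATED family `F′_ω(k) := F_ω(k)·[symbol(k,σ_Y) ≠ 0]`?
  -- Simpler: the dyadic lemma needs the radius bounds only where `F_{ω_Y}(k) ≠ 0` AND we read `‖p‖ ≤ A/ρ`; off the symbol's support `‖p‖ = 0 ≤ A/ρ`
  -- holds too, but the support bound `ρ < Λ′` may fail there.  So shrink the family to the joint support first.
  set p : FreqMomentum L M × Fin 2 → ℂ := fun ks =>
      ((hubbardCutoffWeightCT L M β μ K Λ ks.1 : ℂ) - (hubbardCutoffWeightCT L M β μ K Λ' ks.1 : ℂ)) *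
        (((β * (L : ℝ) ^ 2 : ℝ) : ℂ) *
          ((Complex.I * matsubaraFreq β M ks.1.1 + nambuXiCT L μ K ks.1.2) / nambuDenCT L M β μ 0 K ks.1)) with hp
  set F' : Fin N → FreqMomentum L M → ℂ := fun ω k => if p (k, Y.2.1.2) = 0 then 0 else F ω k with hF'
  have hF'le : ∀ ω k, ‖F' ω k‖ ≤ 1 := fun ω k => by
    simp only [hF']; split_ifs <;> simp [hF ω k]
  -- the entry is unchanged when `F` is replaced by `F′` (the closed form reads `F_ω(k)·p(k,σ)·F_{ω′}(k)` termwise)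
  have hentry : ((sectorSubMatrix L M β F).transpose * normalCovariance L M p * sectorSubMatrix L M β F) Y Y' =
      ((sectorSubMatrix L M β F').transpose * normalCovariance L M p * sectorSubMatrix L M β F') Y Y' := by
    rw [sectorSub_pullback_normalCovariance_apply, sectorSub_pullback_normalCovariance_apply]
    by_cases hσ : Y.2.1.2 = Y'.2.1.2
    · rw [if_pos hσ, if_pos hσ]
      refine sum_congr rfl fun k _ => ?_
      by_cases hpk : p (k, Y.2.1.2) = 0
      · have : (if Y.2.2 = 0 ∧ Y'.2.2 = 1 then p (k, Y.2.1.2) else if Y.2.2 = 1 ∧ Y'.2.2 = 0 then -p (k, Y.2.1.2) else 0) = 0 := by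
          simp only [hpk, neg_zero, ite_self]
        rw [this]; simp
      · simp only [hF', hpk, if_false]
    · rw [if_neg hσ, if_neg hσ]
  rw [hentry]
  refine norm_sectorSub_pullback_normalCovariance_le_of_dyadic β F' hF'le p Y Y'
    (fun k => Real.sqrt (matsubaraFreq β M k.1 ^ 2 + nambuXiCT L μ K k.2 ^ 2)) (Λ := Λ') (ρmin := Λ / 2) (A := β * (L : ℝ) ^ 2)
    (lt_of_lt_of_le hΛ hΛΛ') (by linarith) (by positivity) hC ?_ ?_ ?_
  · -- soft shape
    intro k _
    exact norm_sliceSymbolCT_le_div_radius hβ μ K Λ Λ' (k, Y.2.1.2)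
  · -- radial support where `F′ ≠ 0` (⇒ symbol ≠ 0)
    intro k hk
    have hpk : p (k, Y.2.1.2) ≠ 0 := by
      intro h0; apply hk; simp only [hF', h0, if_true]
    obtain ⟨hlo, hhi⟩ := sliceSymbolCT_radius_mem (L := L) (M := M) (β := β) μ K hΛ hΛΛ' (ks := (k, Y.2.1.2)) hpk
    exact ⟨hlo.le, hhi.le⟩
  · -- annulus counts of `F′` are at most those of `F`
    intro r hr hrΛ
    refine le_trans ?_ (hcount r hr hrΛ)
    exact_mod_cast Finset.card_le_card (fun k hk => by
      simp only [mem_filter, mem_univ, true_and] at hk ⊢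
      refine ⟨fun h0 => hk.1 (by simp only [hF', h0]; split_ifs <;> rfl), hk.2⟩)

/-! ## §3 The soft covariance `D_{n′}` -/

/-- **Sector entry bound of the SOFT covariance, β-uniform** (`klBetaMin ≤ β`, `n′ ≤ n_β + 1`): with the annulus counts of the sector `ω_Y` for `0 < r ≤ Λ_{n′}`,
`‖(S(F)ᵀ·klSoftCov … n′·S(F)) Y Y′‖ ≤ ‖(βL²)⁻¹‖²·(4·βL²·C·Λ_{n′})` — the crude law's `Λ_n/Λ_{n_β+1}` is gone. -/
theorem norm_entry_sectorSub_klSoftCov_le_of_annulusCount [NeZero M] {β : ℝ} (hβ : klBetaMin ≤ β) (μ : ℝ) (K : TrigPolyC4v) {n' : ℕ}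
    (hn : n' ≤ nScales β + 1) (F : Fin N → FreqMomentum L M → ℂ) (hF : ∀ ω k, ‖F ω k‖ ≤ 1) (Y Y' : SpaceTimeIdx L M × SectorLeg N) {C : ℝ} (hC : 0 ≤ C)
    (hcount : ∀ r : ℝ, 0 < r → r ≤ klScale klE0 n' →
      ((((univ : Finset (FreqMomentum L M)).filter (fun k => F Y.2.1.1 k ≠ 0)).filter fun k =>
          r / 2 < Real.sqrt (matsubaraFreq β M k.1 ^ 2 + nambuXiCT L μ K k.2 ^ 2) ∧
            Real.sqrt (matsubaraFreq β M k.1 ^ 2 + nambuXiCT L μ K k.2 ^ 2) ≤ r).card : ℝ) ≤ C * r ^ 2) :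
    ‖((sectorSubMatrix L M β F).transpose * klSoftCov L M β μ K n' * sectorSubMatrix L M β F) Y Y'‖ ≤
      ‖((1 / (β * (L : ℝ) ^ 2) : ℝ) : ℂ)‖ ^ 2 * (4 * (β * (L : ℝ) ^ 2) * C * klScale klE0 n') := by
  rw [klSoftCov_eq_sliceCT_nScales_succ hβ μ K n']
  exact norm_entry_sectorSub_sliceCT_le_of_annulusCount (pos_of_klBetaMin_le hβ).le μ K (klth_klScale_pos _)
    (EngineV8.klScale_le_klScale (by norm_num [klE0]) hn) F hF Y Y' hC hcount

end Summit.HubbardSuperconductivity.HubbardSuperconductivity.Theorems.TorusFourierL2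

end
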